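import Summits.CriticalPhenomena.CardyFormulaZ2.Theses.CardyBoundaryCoulombGas
import Summits.CriticalPhenomena.CardyFormulaZ2.Theorems.StripClusterRates.Negative.KacFromAboveFalse
import Literature.Probability.Percolation.SharpnessDCTProofs
import Literature.Probability.Percolation.NewmanSchulman
import Literature.Probability.Percolation.LatticeSymmetry
import Literature.Probability.Percolation.RSWProofs
import Literature.Probability.Percolation.RSW
import Literature.Probability.Percolation.PlanarDuality

/-!
# `StripRatesExist` (route `CardyBoundaryCoulombGas`, stmt-CriticalPhenomena-13879): both
# lengthwise decay rates of the free strip exist (Fekete)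

For every width `n ≥ 1` the two rate sequences of the crux `StripClusterRates`,
`-log p₁(m,n)/m` with `p₁(m,n) = P_{1/2}[LR crossing of [0,m]×[0,n]] = crossingProb half m n` and
`-log p₂(m,n)/m` with `p₂(m,n) = P_{1/2}[two LR crossings of [0,m]×[0,n] in distinct open clusters
of the rectangle]` (`twoClusterEvent`, `pTwo` of `KacFromAboveFalse.lean`, definitionally the event
of the route file), converge as `m → ∞`.

* `p₁`: the tree's gluing inequality `crossingProb_glue_holds` (Bollobás–Riordan 2006, Ch. 3,
  eq. (2); Harris–FKG + "horizontal and vertical crossings meet") gives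
  `p₁(a+n) p₁(b+n) p₁(n,n) ≤ p₁(a+b+n)`, so `u(m) = -log p₁(m+n) - log p₁(n,n) ≥ 0` is
  subadditive; Fekete (`Subadditive.tendsto_lim`) and a reindexing give the limit
  (`exists_rateOne`, valid for every `n`).
* `p₂`: sub-multiplicativity `p₂(a+b+1) ≤ p₂(a) p₂(b)` (`pTwo_submul`): on lattice configurations
  two spanning clusters of `[0,a+b+1]×[0,n]` that are distinct inside the rectangle restrict —
  first visits to the column `x = a`, last visits to the column `x = a+1`
  (`exists_openConnIn_column`, `exists_openConnIn_column_ge`) — to such pairs in the edge-disjoint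
  blocks `[0,a]×[0,n]` and `[a+1,a+b+1]×[0,n]` (`twoClusterEvent_restrict`); the two block events
  are determined by disjoint sets of pairs, hence independent
  (`DCT16.real_inter_of_determinedBy_disjoint`), and the right one has probability `p₂(b)` by
  translation invariance (`bondPercolation_real_preimage_shift`). With the explicit lower bound
  `p₂(m,n) ≥ 2^{-(3m+1)}` (`pTwo_ge`, `n ≥ 1`) the sequence `log p₂` is shifted-subadditive and
  `≥ -3 log 2 (m+1)`, and Fekete applies again (`exists_rateTwo`).

Sources: folklore sub/super-additivity (Grimmett, *Percolation* (1999), §§6.2, 11.7 style);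
M. Fekete (1923). Tree anchors: `crossingProb_glue_holds`, `pow_le_crossingProb`,
`exists_openConnIn_column(_ge)`, `relabel_mem_openConnIn`, `relabel_symm_relabel`,
`bondPercolation_real_preimage_shift`, `DeterminedBy.preimage_relabel`,
`PlanarDuality.determinedBy_openConnIn`, `DCT16.real_mono_of_forall_subset_edgeSet`; Mathlib
`Subadditive.tendsto_lim`, `Filter.tendsto_add_atTop_iff_nat`, `tendsto_natCast_div_add_atTop`.
-/

noncomputable section

open MeasureTheory Filter Topology
open Literature.Probability.LatticeModels Literature.Probability.Percolation

namespace Summit.CriticalPhenomena.CardyFormulaZ2.Theorems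

open Summit.CriticalPhenomena.CardyFormulaZ2.Theses.CardyBoundaryCoulombGas (StripRatesExist)
open Summit.CriticalPhenomena.CardyFormulaZ2.Theorems.StripClusterRates.Negative
  (pOne pTwo twoClusterEvent pOne_ge pTwo_ge)

namespace StripRates

/-! ## §1 Fekete's lemma with a shift / with an additive constant -/

/-- `(m+1)/m → 1`. [folklore] -/
theorem tendsto_succ_div_self : Tendsto (fun m : ℕ ↦ ((m : ℝ) + 1) / m) atTop (𝓝 1) := by
  have h : Tendsto (fun m : ℕ ↦ 1 + 1 / (m : ℝ)) atTop (𝓝 (1 + 0)) :=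
    tendsto_const_nhds.add (tendsto_const_nhds.div_atTop tendsto_natCast_atTop_atTop)
  rw [add_zero] at h
  refine h.congr' ?_
  filter_upwards [eventually_ge_atTop 1] with m hm
  have : (m : ℝ) ≠ 0 := by exact_mod_cast Nat.one_le_iff_ne_zero.mp hm
  field_simp

/-- **Fekete's lemma, shifted form**: if `u (a + b + 1) ≤ u a + u b` for all `a, b` and
`u m ≥ -B (m + 1)`, then `u m / m` converges. (Apply Mathlib's `Subadditive.tendsto_lim` to
`k ↦ u (k - 1)`, `0 ↦ 0`.) [folklore] -/
theorem exists_tendsto_of_shifted_subadditive {u : ℕ → ℝ} {B : ℝ}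
    (hsub : ∀ a b, u (a + b + 1) ≤ u a + u b) (hbdd : ∀ m : ℕ, -(B * ((m : ℝ) + 1)) ≤ u m) :
    ∃ L : ℝ, Tendsto (fun m : ℕ ↦ u m / m) atTop (𝓝 L) := by
  set v : ℕ → ℝ := fun k ↦ if k = 0 then 0 else u (k - 1) with hv
  have hsv : Subadditive v := by
    intro a b
    rcases Nat.eq_zero_or_pos a with rfl | ha
    · simp [hv]
    rcases Nat.eq_zero_or_pos b with rfl | hb
    · simp [hv]
    have hab : a + b ≠ 0 := by omega
    simp only [hv, hab, ha.ne', hb.ne', if_false]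
    have : a + b - 1 = (a - 1) + (b - 1) + 1 := by omega
    rw [this]
    exact hsub _ _
  have hbd : BddBelow (Set.range fun k ↦ v k / k) := by
    refine ⟨min (-B) 0, ?_⟩
    rintro _ ⟨k, rfl⟩
    rcases Nat.eq_zero_or_pos k with rfl | hk
    · simp [hv]
    · have hk' : (0 : ℝ) < k := by exact_mod_cast hk
      simp only [hv, hk.ne', if_false]
      refine (min_le_left _ _).trans ?_
      rw [le_div_iff₀ hk']
      have h1 := hbdd (k - 1)
      have hcast : ((k - 1 : ℕ) : ℝ) + 1 = k := by
        rw [Nat.cast_sub hk]; push_cast; ring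
      rw [hcast] at h1
      linarith
  have hlim := hsv.tendsto_lim hbd
  refine ⟨hsv.lim, ?_⟩
  have h1 : Tendsto (fun m : ℕ ↦ u m / ((m : ℝ) + 1)) atTop (𝓝 hsv.lim) := by
    have h0 := (tendsto_add_atTop_iff_nat 1).2 hlim
    refine h0.congr' (Eventually.of_forall fun m ↦ ?_)
    simp [hv]
  have h2 := h1.mul tendsto_succ_div_self
  rw [mul_one] at h2
  refine h2.congr' ?_
  filter_upwards [eventually_ge_atTop 1] with m hm
  have : (m : ℝ) ≠ 0 := by exact_mod_cast Nat.one_le_iff_ne_zero.mp hm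
  have : (m : ℝ) + 1 ≠ 0 := by positivity
  field_simp

/-- **Fekete's lemma with an additive constant and a shift**: if
`u (a + b + k) ≤ u (a + k) + u (b + k) + C` with `C ≥ 0` and `u ≥ 0`, then `u m / m` converges.
(Mathlib's `Subadditive.tendsto_lim` for `m ↦ u (m + k) + C`, then reindexing.) [folklore] -/
theorem exists_tendsto_of_subadditive_const {u : ℕ → ℝ} {C : ℝ} {k : ℕ}
    (hsub : ∀ a b, u (a + b + k) ≤ u (a + k) + u (b + k) + C) (hC : 0 ≤ C) (hu : ∀ m, 0 ≤ u m) :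
    ∃ L : ℝ, Tendsto (fun m : ℕ ↦ u m / m) atTop (𝓝 L) := by
  set v : ℕ → ℝ := fun m ↦ u (m + k) + C with hv
  have hsv : Subadditive v := by
    intro a b
    simp only [hv]
    have := hsub a b
    linarith
  have hbd : BddBelow (Set.range fun m ↦ v m / m) := by
    refine ⟨0, ?_⟩
    rintro _ ⟨m, rfl⟩
    exact div_nonneg (add_nonneg (hu _) hC) (Nat.cast_nonneg _)
  have hlim := hsv.tendsto_lim hbd
  refine ⟨hsv.lim, ?_⟩
  -- `u (m + k) / m → L`
  have h1 : Tendsto (fun m : ℕ ↦ u (m + k) / m) atTop (𝓝 hsv.lim) := by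
    have hC0 : Tendsto (fun m : ℕ ↦ C / (m : ℝ)) atTop (𝓝 0) :=
      tendsto_const_nhds.div_atTop tendsto_natCast_atTop_atTop
    have h0 := hlim.sub hC0
    rw [sub_zero] at h0
    refine h0.congr' (Eventually.of_forall fun m ↦ ?_)
    simp only [hv]
    ring
  -- `u (m + k) / (m + k) → L`
  have h2 : Tendsto (fun m : ℕ ↦ u (m + k) / ((m + k : ℕ) : ℝ)) atTop (𝓝 hsv.lim) := by
    have h3 : Tendsto (fun m : ℕ ↦ (m : ℝ) / ((m : ℝ) + k)) atTop (𝓝 1) :=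
      tendsto_natCast_div_add_atTop (k : ℝ)
    have h4 := h1.mul h3
    rw [mul_one] at h4
    refine h4.congr' ?_
    filter_upwards [eventually_ge_atTop 1] with m hm
    have hm0 : (m : ℝ) ≠ 0 := by exact_mod_cast Nat.one_le_iff_ne_zero.mp hm
    have hmk : (m : ℝ) + k ≠ 0 := by positivity
    push_cast
    field_simp
  exact (tendsto_add_atTop_iff_nat k).1 h2

/-! ## §2 The one-cluster rate: super-multiplicativity of `p₁` by gluing -/

/-- **Existence of `γ₁(n) = lim_m -log p₁(m,n)/m`** for every width `n` (from
`crossingProb_glue_holds`: `p₁(a+n) p₁(b+n) p₁(n,n) ≤ p₁(a+b+n)`, and Fekete). [folklore] -/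
theorem exists_rateOne (n : ℕ) :
    ∃ γ : ℝ, Tendsto (fun m : ℕ ↦ -Real.log (crossingProb half m n) / (m : ℝ)) atTop (𝓝 γ) := by
  have hpos : ∀ m, 0 < crossingProb half m n := fun m ↦
    lt_of_lt_of_le (by positivity) (pOne_ge m n)
  have hle : ∀ m, crossingProb half m n ≤ 1 := fun m ↦ (crossingProb_mem_Icc half m n).2
  have hc0 : 0 < crossingProb half n n := hpos n
  refine exists_tendsto_of_subadditive_const (u := fun m ↦ -Real.log (crossingProb half m n))
    (C := -Real.log (crossingProb half n n)) (k := n) ?_ ?_ ?_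
  · intro a b
    have hglue := crossingProb_glue_holds half (a + n) (b + n) n (by omega) (by omega)
    have heq : a + n + (b + n) - n = a + b + n := by omega
    rw [heq] at hglue
    have hprod : 0 < crossingProb half (a + n) n * crossingProb half (b + n) n * crossingProb half n n :=
      mul_pos (mul_pos (hpos _) (hpos _)) hc0
    have hlog := Real.log_le_log hprod hglue
    rw [Real.log_mul (mul_pos (hpos _) (hpos _)).ne' hc0.ne',
      Real.log_mul (hpos _).ne' (hpos _).ne'] at hlog
    show -Real.log (crossingProb half (a + b + n) n) ≤
      -Real.log (crossingProb half (a + n) n) + -Real.log (crossingProb half (b + n) n) +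
        -Real.log (crossingProb half n n)
    linarith
  · have := Real.log_nonpos (hpos n).le (hle n)
    linarith
  · intro m
    have := Real.log_nonpos (hpos m).le (hle m)
    show 0 ≤ -Real.log _
    linarith

/-! ## §3 The two-cluster event: locality, restriction to blocks, sub-multiplicativity -/

/-- The two-cluster event of `[0,m]×[0,n]` is determined by the pairs of the rectangle. [folklore] -/
theorem determinedBy_twoClusterEvent (m n : ℕ) :
    DeterminedBy (twoClusterEvent m n) (↑(rectangle m n).sym2 : Set (Sym2 (Site 2))) := by
  rw [determinedBy_iff]
  intro ω ω' h
  have key : ∀ x y : Site 2, (ω ∈ openConnIn (↑(rectangle m n) : Set (Site 2)) x y ↔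
      ω' ∈ openConnIn (↑(rectangle m n) : Set (Site 2)) x y) := fun x y ↦
    (determinedBy_iff _ _).1 (PlanarDuality.determinedBy_openConnIn (rectangle m n) x y) ω ω' h
  simp only [twoClusterEvent, Set.mem_setOf_eq, key]

/-- The pairs of the left block `[0,a]×[0,n]` and the pull-backs of the pairs of `[0,b]×[0,n]`
along the shift by `-(a+1,0)` (i.e. the pairs of the right block `[a+1,a+b+1]×[0,n]`) are
disjoint. [folklore] -/
theorem disjoint_blockPairs (a b n : ℕ) :
    Disjoint (rectangle a n).sym2
      (((rectangle b n).sym2).image (sym2Equiv (Site.shift (-pt ((a : ℤ) + 1) 0))).symm) := by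
  rw [Finset.disjoint_left]
  intro z hz hz'
  rw [Finset.mem_image] at hz'
  obtain ⟨z₀, hz₀, rfl⟩ := hz'
  rw [Finset.mem_sym2_iff] at hz hz₀
  set x₀ : Site 2 := z₀.out.1 with hx₀
  have hx₀z : x₀ ∈ z₀ := Sym2.out_fst_mem z₀
  have hx₀R : x₀ ∈ rectangle b n := hz₀ x₀ hx₀z
  have hmem : (Site.shift (-pt ((a : ℤ) + 1) 0)).symm x₀ ∈
      (sym2Equiv (Site.shift (-pt ((a : ℤ) + 1) 0))).symm z₀ := by
    rw [sym2Equiv_symm, sym2Equiv_apply, Sym2.mem_map]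
    exact ⟨x₀, hx₀z, rfl⟩
  have hx₀L := hz _ hmem
  rw [mem_rectangle_iff] at hx₀R hx₀L
  simp only [Site.shift_symm_apply, Pi.sub_apply, Pi.neg_apply, pt, Matrix.cons_val_zero,
    Matrix.cons_val_one, Matrix.cons_val_fin_one] at hx₀L
  omega

/-- The shift by `-(a+1,0)` carries the right block `[0,a+b+1]×[0,n] ∩ {a+1 ≤ x}` onto
`[0,b]×[0,n]`. [folklore] -/
theorem image_shift_rightBlock (a b n : ℕ) :
    (Site.shift (-pt ((a : ℤ) + 1) 0)) '' ((↑(rectangle (a + b + 1) n) : Set (Site 2)) ∩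
        {z | (a : ℤ) + 1 ≤ z 0}) = (↑(rectangle b n) : Set (Site 2)) := by
  ext z
  simp only [Set.mem_image, Set.mem_inter_iff, Finset.mem_coe, mem_rectangle_iff,
    Set.mem_setOf_eq, Site.shift_apply]
  constructor
  · rintro ⟨w, ⟨⟨hw0, hw1, hw2, hw3⟩, hw4⟩, rfl⟩
    simp only [Pi.add_apply, Pi.neg_apply, pt, Matrix.cons_val_zero, Matrix.cons_val_one,
        Matrix.cons_val_fin_one]
    omega
  · rintro ⟨hz0, hz1, hz2, hz3⟩
    refine ⟨z + pt ((a : ℤ) + 1) 0, ⟨⟨?_, ?_, ?_, ?_⟩, ?_⟩, ?_⟩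
    · simp only [Pi.add_apply, pt, Matrix.cons_val_zero]; omega
    · simp only [Pi.add_apply, pt, Matrix.cons_val_zero]; omega
    · simp only [Pi.add_apply, pt, Matrix.cons_val_one, Matrix.cons_val_fin_one]; omega
    · simp only [Pi.add_apply, pt, Matrix.cons_val_one, Matrix.cons_val_fin_one]; omega
    · simp only [Pi.add_apply, pt, Matrix.cons_val_zero]; omega
    · exact add_neg_cancel_right z _

/-- **Restriction of the two-cluster event to the two blocks** (lattice configurations). If
`[0,a+b+1]×[0,n]` has two open LR crossings in distinct open clusters of the rectangle, then
(i) stopping both at their first visits to the column `x = a` gives two LR crossings of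
`[0,a]×[0,n]` in distinct clusters of that block, and (ii) the parts after their last visits to
the column `x = a+1` are two LR crossings of the right block `[a+1,a+b+1]×[0,n]` in distinct
clusters of that block — stated for the configuration shifted by `-(a+1,0)`. In both cases a
connection inside the sub-block would connect the two clusters inside the big rectangle. [folklore] -/
theorem twoClusterEvent_restrict {a b n : ℕ} {ω : BondConfig (Site 2)}
    (hω : ω ⊆ (zdGraph 2).edgeSet) (h : ω ∈ twoClusterEvent (a + b + 1) n) :
    ω ∈ twoClusterEvent a n ∧
      BondConfig.relabel (sym2Equiv (Site.shift (-pt ((a : ℤ) + 1) 0))) ω ∈ twoClusterEvent b n := by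
  obtain ⟨x₁, hx₁, y₁, hy₁, x₂, hx₂, y₂, hy₂, h₁, h₂, h₁₂⟩ := h
  simp only [Finset.mem_coe, leftSide, rightSide, Finset.mem_filter, mem_rectangle_iff]
    at hx₁ hy₁ hx₂ hy₂
  set R : Set (Site 2) := ↑(rectangle (a + b + 1) n) with hR
  constructor
  · -- (i) the left block
    have hsub : R ∩ {z : Site 2 | z 0 ≤ (a : ℤ)} ⊆ (↑(rectangle a n) : Set (Site 2)) := by
      intro w hw
      simp only [hR, Set.mem_inter_iff, Finset.mem_coe, mem_rectangle_iff, Set.mem_setOf_eq]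
        at hw ⊢
      omega
    have hRsub : (↑(rectangle a n) : Set (Site 2)) ⊆ R := by
      rw [hR]; exact_mod_cast rectangle_mono (by omega) le_rfl
    obtain ⟨z₁, hz₁, hr₁⟩ := exists_openConnIn_column hω (a : ℤ) (by omega) (by omega) h₁
    obtain ⟨z₂, hz₂, hr₂⟩ := exists_openConnIn_column hω (a : ℤ) (by omega) (by omega) h₂
    have hr₁' := openConnIn_mono hsub x₁ z₁ hr₁
    have hr₂' := openConnIn_mono hsub x₂ z₂ hr₂
    refine ⟨x₁, ?_, z₁, ?_, x₂, ?_, z₂, ?_, hr₁', hr₂',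
      fun h' ↦ h₁₂ (openConnIn_mono hRsub x₁ x₂ h')⟩
    · simp only [Finset.mem_coe, leftSide, Finset.mem_filter, mem_rectangle_iff]; omega
    · obtain ⟨-, hz, -⟩ := hr₁'
      simp only [Finset.mem_coe, rightSide, Finset.mem_filter] at hz ⊢
      exact ⟨hz, hz₁⟩
    · simp only [Finset.mem_coe, leftSide, Finset.mem_filter, mem_rectangle_iff]; omega
    · obtain ⟨-, hz, -⟩ := hr₂'
      simp only [Finset.mem_coe, rightSide, Finset.mem_filter] at hz ⊢
      exact ⟨hz, hz₂⟩
  · -- (ii) the right block, shifted back to `[0,b]×[0,n]`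
    set S : Set (Site 2) := R ∩ {z : Site 2 | (a : ℤ) + 1 ≤ z 0} with hS
    set φ : Site 2 ≃ Site 2 := Site.shift (-pt ((a : ℤ) + 1) 0) with hφ
    have hSR : S ⊆ R := Set.inter_subset_left
    have h₁' : ω ∈ openConnIn R y₁ x₁ := by rw [openConnIn_comm]; exact h₁
    have h₂' : ω ∈ openConnIn R y₂ x₂ := by rw [openConnIn_comm]; exact h₂
    obtain ⟨w₁, hw₁, hr₁⟩ := exists_openConnIn_column_ge hω ((a : ℤ) + 1) (by omega) (by omega) h₁'
    obtain ⟨w₂, hw₂, hr₂⟩ := exists_openConnIn_column_ge hω ((a : ℤ) + 1) (by omega) (by omega) h₂'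
    -- `hrᵢ : ω ∈ openConnIn S yᵢ wᵢ`
    have hnot : ω ∉ openConnIn S w₁ w₂ := by
      intro h'
      apply h₁₂
      have e1 : ω ∈ openConnIn R y₁ w₁ := openConnIn_mono hSR _ _ hr₁
      have e2 : ω ∈ openConnIn R w₁ w₂ := openConnIn_mono hSR _ _ h'
      have e3 : ω ∈ openConnIn R w₂ y₂ := by
        rw [openConnIn_comm]; exact openConnIn_mono hSR _ _ hr₂
      exact PlanarDuality.openConnIn_trans (PlanarDuality.openConnIn_trans
        (PlanarDuality.openConnIn_trans (PlanarDuality.openConnIn_trans h₁ e1) e2) e3) h₂'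
    have hs₁ : ω ∈ openConnIn S w₁ y₁ := by rw [openConnIn_comm]; exact hr₁
    have hs₂ : ω ∈ openConnIn S w₂ y₂ := by rw [openConnIn_comm]; exact hr₂
    have hw₁S : w₁ ∈ S := hs₁.1
    have hw₂S : w₂ ∈ S := hs₂.1
    have t₁ := relabel_mem_openConnIn φ hs₁
    have t₂ := relabel_mem_openConnIn φ hs₂
    have tnot : BondConfig.relabel (sym2Equiv φ) ω ∉ openConnIn (φ '' S) (φ w₁) (φ w₂) := by
      intro h'
      apply hnot
      have h'' := relabel_mem_openConnIn φ.symm h'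
      rwa [relabel_symm_relabel, Equiv.symm_image_image, Equiv.symm_apply_apply,
        Equiv.symm_apply_apply] at h''
    have himg : φ '' S = (↑(rectangle b n) : Set (Site 2)) := image_shift_rightBlock a b n
    rw [himg] at t₁ t₂ tnot
    simp only [hS, hR, Set.mem_inter_iff, Finset.mem_coe, mem_rectangle_iff, Set.mem_setOf_eq]
      at hw₁S hw₂S
    refine ⟨φ w₁, ?_, φ y₁, ?_, φ w₂, ?_, φ y₂, ?_, t₁, t₂, tnot⟩
    · simp only [hφ, Site.shift_apply, Finset.mem_coe, leftSide, Finset.mem_filter,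
        mem_rectangle_iff, Pi.add_apply, Pi.neg_apply, pt, Matrix.cons_val_zero, Matrix.cons_val_one,
        Matrix.cons_val_fin_one]
      omega
    · simp only [hφ, Site.shift_apply, Finset.mem_coe, rightSide, Finset.mem_filter,
        mem_rectangle_iff, Pi.add_apply, Pi.neg_apply, pt, Matrix.cons_val_zero, Matrix.cons_val_one,
        Matrix.cons_val_fin_one]
      omega
    · simp only [hφ, Site.shift_apply, Finset.mem_coe, leftSide, Finset.mem_filter,
        mem_rectangle_iff, Pi.add_apply, Pi.neg_apply, pt, Matrix.cons_val_zero, Matrix.cons_val_one,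
        Matrix.cons_val_fin_one]
      omega
    · simp only [hφ, Site.shift_apply, Finset.mem_coe, rightSide, Finset.mem_filter,
        mem_rectangle_iff, Pi.add_apply, Pi.neg_apply, pt, Matrix.cons_val_zero, Matrix.cons_val_one,
        Matrix.cons_val_fin_one]
      omega

/-- **Sub-multiplicativity of `p₂`**: `p₂(a+b+1, n) ≤ p₂(a, n) · p₂(b, n)` — restriction to the
two edge-disjoint blocks (`twoClusterEvent_restrict`), independence of events determined by
disjoint sets of pairs, and translation invariance of `P_{1/2}`. [folklore] -/
theorem pTwo_submul (a b n : ℕ) : pTwo (a + b + 1) n ≤ pTwo a n * pTwo b n := by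
  set e : Sym2 (Site 2) ≃ Sym2 (Site 2) := sym2Equiv (Site.shift (-pt ((a : ℤ) + 1) 0)) with he
  set B : Set (BondConfig (Site 2)) := BondConfig.relabel e ⁻¹' twoClusterEvent b n with hB
  have h1 : pTwo (a + b + 1) n ≤
      (bondPercolation (zdGraph 2) half).real (twoClusterEvent a n ∩ B) :=
    DCT16.real_mono_of_forall_subset_edgeSet (zdGraph 2) half
      fun ω hω h ↦ twoClusterEvent_restrict hω h
  have hA : DeterminedBy (twoClusterEvent a n) (↑(rectangle a n).sym2 : Set (Sym2 (Site 2))) :=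
    determinedBy_twoClusterEvent a n
  have hB' : DeterminedBy B (↑(((rectangle b n).sym2).image e.symm) : Set (Sym2 (Site 2))) := by
    rw [Finset.coe_image]
    exact (determinedBy_twoClusterEvent b n).preimage_relabel e
  have h2 := DCT16.real_inter_of_determinedBy_disjoint (zdGraph 2) half hA hB'
    (disjoint_blockPairs a b n)
  have h3 : (bondPercolation (zdGraph 2) half).real B = pTwo b n :=
    bondPercolation_real_preimage_shift (-pt ((a : ℤ) + 1) 0) half (twoClusterEvent b n)
  calc pTwo (a + b + 1) n ≤ _ := h1
    _ = _ := h2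
    _ = pTwo a n * pTwo b n := by rw [h3]

/-! ## §4 The two-cluster rate -/

/-- **Existence of `γ₂(n) = lim_m -log p₂(m,n)/m`** for `n ≥ 1` (sub-multiplicativity
`pTwo_submul`, the lower bound `pTwo_ge`, Fekete in the shifted form). [folklore] -/
theorem exists_rateTwo {n : ℕ} (hn : 1 ≤ n) :
    ∃ γ : ℝ, Tendsto (fun m : ℕ ↦ -Real.log (pTwo m n) / (m : ℝ)) atTop (𝓝 γ) := by
  have hpos : ∀ m, 0 < pTwo m n := fun m ↦ lt_of_lt_of_le (by positivity) (pTwo_ge hn)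
  have hlog2 : 0 < Real.log 2 := Real.log_pos one_lt_two
  have hsub : ∀ a b, Real.log (pTwo (a + b + 1) n) ≤ Real.log (pTwo a n) + Real.log (pTwo b n) := by
    intro a b
    have h := Real.log_le_log (hpos _) (pTwo_submul a b n)
    rwa [Real.log_mul (hpos a).ne' (hpos b).ne'] at h
  have hbdd : ∀ m : ℕ, -(3 * Real.log 2 * ((m : ℝ) + 1)) ≤ Real.log (pTwo m n) := by
    intro m
    have h := Real.log_le_log (by positivity) (pTwo_ge (m := m) hn)
    rw [Real.log_pow, one_div, Real.log_inv] at h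
    push_cast at h
    nlinarith
  obtain ⟨L, hL⟩ := exists_tendsto_of_shifted_subadditive (u := fun m ↦ Real.log (pTwo m n))
    (B := 3 * Real.log 2) hsub hbdd
  refine ⟨-L, ?_⟩
  refine (hL.neg).congr' (Eventually.of_forall fun m ↦ ?_)
  simp only [neg_div]

end StripRates

/-- **`StripRatesExist`** (support item stmt-CriticalPhenomena-13879 of route
`CardyBoundaryCoulombGas`): for every `n ≥ 1` both lengthwise rates of the free strip exist,
`-log p₁(m,n)/m → γ₁(n)` and `-log p₂(m,n)/m → γ₂(n)`. [folklore] -/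
theorem StripRatesExist_proof : StripRatesExist := by
  intro n hn
  exact ⟨StripRates.exists_rateOne n, StripRates.exists_rateTwo hn⟩

end Summit.CriticalPhenomena.CardyFormulaZ2.Theorems
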